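import Summits.Ventures.PercRepro.Decide

/-!
# A conditional-correlation candidate is false: a kernel-checked refutation

mine-4's conditional-correlation family (`conjectures/KILLED.md`, orbit `A = a~b`,
`B = a~c ∧ a~d`, `E = a~c ∨ b~c`, sign `+`, `k = 4`): the candidate `M4CondCorr` asserts the
positive correlation of `A` and `B` given `E`, `P(A ∧ B ∧ E) · P(E) ≥ P(A ∧ E) · P(B ∧ E)`, for every
finite multigraph, every `p ∈ [0,1]^E` and every four marked vertices.  mine-4's witness (INBOX
2026-08-22T03:15:40Z; row by the lead 03:16:34Z): vertices `0 … 5`, edges `0–3 1/2`, `0–4 1`,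
`1–2 1/2`, `1–4 1/2`, `2–3 1/2` and the pendant `1–5 1/30`, marks `(a, b, c, d) = (0, 5, 2, 3)`.
Over the `64` configurations the four probabilities are `(5, 213, 6, 180) / 480` (kernel, one
pass: `probNat4_cc`), and `P(ABE) P(E) − P(AE) P(BE) = (5 · 213 − 6 · 180) / 480² = −15 / 230400
= −1/15360`: `not_M4CondCorr`.
-/

namespace PercRepro

/-- **M4CondCorr** (mine-4's conditional-correlation orbit, status KILLED): for `A = a~b`,
`B = a~c ∧ a~d`, `E = a~c ∨ b~c`, `P(A ∧ B ∧ E) · P(E) ≥ P(A ∧ E) · P(B ∧ E)`. -/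
def M4CondCorr : Prop :=
  ∀ {V E : Type} [Fintype E] [DecidableEq E] (G : MultiGraph V E) (p : E → ℝ), IsProb p →
    ∀ a b c d : V,
      prob p (G.connEvent a b ∩ (G.connEvent a c ∩ G.connEvent a d) ∩
            (G.connEvent a c ∪ G.connEvent b c)) *
          prob p (G.connEvent a c ∪ G.connEvent b c) ≥
        prob p (G.connEvent a b ∩ (G.connEvent a c ∪ G.connEvent b c)) *
          prob p ((G.connEvent a c ∩ G.connEvent a d) ∩ (G.connEvent a c ∪ G.connEvent b c))

section FourEvents

variable {E : Type*} [Fintype E] [DecidableEq E]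

/-- Four integer event numerators in one pass over the configurations. -/
def probNat4 (num den : E → ℕ) (A B C D : Set (Config E)) [DecidablePred (· ∈ A)]
    [DecidablePred (· ∈ B)] [DecidablePred (· ∈ C)] [DecidablePred (· ∈ D)] : ℕ × ℕ × ℕ × ℕ :=
  ∑ ω : Config E, ((if ω ∈ A then weightNat num den ω else 0),
    (if ω ∈ B then weightNat num den ω else 0), (if ω ∈ C then weightNat num den ω else 0),
    (if ω ∈ D then weightNat num den ω else 0))

/-- The one-pass tuple is the tuple of `probNat` values. -/
theorem probNat4_eq (num den : E → ℕ) (A B C D : Set (Config E)) [DecidablePred (· ∈ A)]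
    [DecidablePred (· ∈ B)] [DecidablePred (· ∈ C)] [DecidablePred (· ∈ D)] :
    probNat4 num den A B C D =
      (probNat num den A, probNat num den B, probNat num den C, probNat num den D) := by
  unfold probNat4 probNat
  rw [Prod.ext_iff, Prod.ext_iff, Prod.ext_iff]
  simp [Prod.fst_sum, Prod.snd_sum, Finset.sum_filter]

end FourEvents

namespace Examples

open MultiGraph

/-- mine-4's witness: edges `0: 0–3`, `1: 0–4`, `2: 1–2`, `3: 1–4`, `4: 2–3`, `5: 1–5` (pendant);
marks `a = 0`, `b = 5`, `c = 2`, `d = 3`. -/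
def ccgraph : MultiGraph (Fin 6) (Fin 6) := ⟨![0, 0, 1, 1, 2, 1], ![3, 4, 2, 4, 3, 5]⟩

/-- Numerators of the witness weights `1/2, 1, 1/2, 1/2, 1/2, 1/30`. -/
def ccnum : Fin 6 → ℕ := ![1, 1, 1, 1, 1, 1]

/-- Denominators of the witness weights. -/
def ccden : Fin 6 → ℕ := ![2, 1, 2, 2, 2, 30]

/-- The witness weights as real edge probabilities. -/
noncomputable def ccp : Fin 6 → ℝ := fun e => (ccnum e : ℝ) / ccden e

/-- The witness weights lie in `[0, 1]`. -/
theorem isProb_ccp : IsProb ccp := by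
  intro e
  fin_cases e <;> norm_num [ccp, ccnum, ccden]

/-- The four event numerators `(P(ABE), P(E), P(AE), P(BE)) · 480 = (5, 213, 6, 180)` in one kernel
pass over the `64` configurations. -/
theorem probNat4_cc :
    probNat4 ccnum ccden
      (ccgraph.connEvent 0 5 ∩ (ccgraph.connEvent 0 2 ∩ ccgraph.connEvent 0 3) ∩
        (ccgraph.connEvent 0 2 ∪ ccgraph.connEvent 5 2))
      (ccgraph.connEvent 0 2 ∪ ccgraph.connEvent 5 2)
      (ccgraph.connEvent 0 5 ∩ (ccgraph.connEvent 0 2 ∪ ccgraph.connEvent 5 2))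
      ((ccgraph.connEvent 0 2 ∩ ccgraph.connEvent 0 3) ∩
        (ccgraph.connEvent 0 2 ∪ ccgraph.connEvent 5 2)) = (5, 213, 6, 180) := by
  decide +kernel

/-- **The candidate is false**: on mine-4's witness `P(ABE) P(E) − P(AE) P(BE) = −1/15360`. -/
theorem not_M4CondCorr : ¬ M4CondCorr := by
  intro h
  have hc := h ccgraph ccp isProb_ccp 0 5 2 3
  have hab : ∀ e, ccnum e ≤ ccden e := fun e => by
    fin_cases e <;> norm_num [ccnum, ccden]
  have hb : ∀ e, 0 < ccden e := fun e => by
    fin_cases e <;> norm_num [ccden]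
  have hprod : (∏ e, (ccden e : ℝ)) = 480 := by
    simp [Fin.prod_univ_succ, ccden]
    norm_num
  have ht := probNat4_cc
  rw [probNat4_eq] at ht
  simp only [Prod.mk.injEq] at ht
  obtain ⟨h1, h2, h3, h4⟩ := ht
  have c1 := probNat_cast ccnum ccden hab hb (ccgraph.connEvent 0 5 ∩
    (ccgraph.connEvent 0 2 ∩ ccgraph.connEvent 0 3) ∩ (ccgraph.connEvent 0 2 ∪ ccgraph.connEvent 5 2))
  have c2 := probNat_cast ccnum ccden hab hb (ccgraph.connEvent 0 2 ∪ ccgraph.connEvent 5 2)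
  have c3 := probNat_cast ccnum ccden hab hb (ccgraph.connEvent 0 5 ∩
    (ccgraph.connEvent 0 2 ∪ ccgraph.connEvent 5 2))
  have c4 := probNat_cast ccnum ccden hab hb ((ccgraph.connEvent 0 2 ∩ ccgraph.connEvent 0 3) ∩
    (ccgraph.connEvent 0 2 ∪ ccgraph.connEvent 5 2))
  rw [h1, hprod] at c1
  rw [h2, hprod] at c2
  rw [h3, hprod] at c3
  rw [h4, hprod] at c4
  have hp : (fun e => (ccnum e : ℝ) / ccden e) = ccp := rfl
  rw [hp] at c1 c2 c3 c4
  push_cast at c1 c2 c3 c4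
  have e1 : prob ccp (ccgraph.connEvent 0 5 ∩ (ccgraph.connEvent 0 2 ∩ ccgraph.connEvent 0 3) ∩
      (ccgraph.connEvent 0 2 ∪ ccgraph.connEvent 5 2)) = 5 / 480 := by linarith
  have e2 : prob ccp (ccgraph.connEvent 0 2 ∪ ccgraph.connEvent 5 2) = 213 / 480 := by linarith
  have e3 : prob ccp (ccgraph.connEvent 0 5 ∩ (ccgraph.connEvent 0 2 ∪ ccgraph.connEvent 5 2)) =
      6 / 480 := by linarith
  have e4 : prob ccp ((ccgraph.connEvent 0 2 ∩ ccgraph.connEvent 0 3) ∩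
      (ccgraph.connEvent 0 2 ∪ ccgraph.connEvent 5 2)) = 180 / 480 := by linarith
  rw [e1, e2, e3, e4] at hc
  norm_num at hc

end Examples

end PercRepro
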